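import Literature.AlgebraicGeometry.HodgeTheory.HodgeRiemannDegreeOneProofs
import HarnessLib

/-!
# Crux `WeilTwelvefoldsSqrtMinus7` (stmt-HodgeConjecture-1261), line `amnesic-secant-sheaves-split-fourteenfolds` — the Hodge–Riemann leaf CLOSED

The composition of the lead's skeleton (`Cruxes/WeilTwelvefoldsSqrtMinus7/Lines/amnesic_secant_sheaves_split_fourteenfolds_c1.lean`,
reshape r6) had exactly two leaves without proof: S1 (hyperbolic `ℚ(√-7)`-Weil fourteenfolds, open mathematics) and
the registered stub `stub_hodgeRiemannDegreeOne` — Hodge–Riemann in degree one for the hyperplane class on the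
summit carriers, in the rational class-identity form (Voisin I Thm. 6.32 at `k = 1`), filed by the lead as the
Literature named fact `hodgeRiemann_degreeOne` (p107682) and since PROVED in the tree for every Hodge model
(`Literature.AlgebraicGeometry.HodgeTheory.hodgeRiemann_degreeOne`, file `HodgeTheory/HodgeRiemannDegreeOneProofs`,
2026-08-16: pointwise Hodge–Riemann for a closed `(1,0)`-form against the restricted Fubini–Study metric, integration
to the top class, `ι^*a = s·H` with `s ∈ ℝ^×`). This file closes the leaf BY NAME (the stub's extra hypothesis
`M.IsReal` is simply not needed).
-/

noncomputable section

set_option linter.dupNamespace false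

open CategoryTheory Complex
open Literature.AlgebraicGeometry Literature.AlgebraicGeometry.Motives
  Literature.AlgebraicGeometry.HodgeTheory Literature.AlgebraicTopology.SingularHomology

namespace Summit.HodgeConjecture.HodgeConjecture.Theorems.WeilTwelvefoldsSqrtMinus7.AmnesicSecantSheaves

/-- **The Hodge–Riemann leaf of the line, closed** (registered stub `stub_hodgeRiemannDegreeOne`): for `X` smooth
projective of dimension `d + 1`, a projective embedding `e`, a non-zero rational `a ∈ H²(ℙᴺ(ℂ); ℂ)`, `h = e^*a`, and a
real Hodge model `M`, there is a non-zero rational top class `ω₀` with `i · hᵈ ⌣ (x ⌣ x̄) = t · ω₀`, `t > 0`, for every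
non-zero `x` of type `(1,0)` — the tree's theorem `hodgeRiemann_degreeOne` (which holds for every model).
[cite: VoisinHodgeI2002, Thm. 6.32, §7.1.2 and Thm. 7.10] -/
theorem stub_hodgeRiemannDegreeOne :
    ∀ ⦃d : ℕ⦄ ⦃X : SchemeOver ℂ⦄, IsSmoothProjective (d + 1) X →
      ∀ (e : ProjectiveEmbedding X) (a : complexBetti (projectiveSpace e.n ℂ) 2),
        IsRationalClass a → a ≠ 0 →
      ∀ (M : HodgeModel (d + 1) X), M.IsReal →
        ∃ ω₀ : complexBetti X (2 + 2 * d), IsRationalClass ω₀ ∧ ω₀ ≠ 0 ∧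
          ∀ x : complexBetti X 1, M.pullback 1 x ∈ M.hodgePQ 1 1 0 → x ≠ 0 →
            ∃ t : ℝ, 0 < t ∧
              Complex.I • polarizationPairingOne X (complexBetti.map e.ι 2 a) d x
                (conjClass (ComplexPoints X) 1 x) = (t : ℂ) • ω₀ :=
  fun _ _ hX e _ ha ha0 M _ => hodgeRiemann_degreeOne hX e ha ha0 M

end Summit.HodgeConjecture.HodgeConjecture.Theorems.WeilTwelvefoldsSqrtMinus7.AmnesicSecantSheaves

end
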